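import Summits.QuantumFields.Balaban3D.Proofs.CouplingWindow

/-!
# Bałaban CMP 102 (1985) 255–275, d = 3 — prover seat p6 (lane `pub-balaban3d`): the coupling threshold `γ₂₈` of the
# smallness clause of (28) «for g₀ sufficiently small the number on the right-hand side above is small» as a CLOSED
# CONSTANT with its export lemma (lane ruling R-EPS0′: every «for g_k sufficiently small» is read `g_k ≤ γ₀` with one
# explicit `γ₀` = the minimum of the seats' named thresholds, seat p3's `Constants.gammaMin`)

Source: T. Bałaban, Commun. Math. Phys. **102** (1985) 255–275 [Balaban1985UV3], (28) p. 263 L28–33 (render p009 read as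
image): «|B(c)| < 4L²|c₋ − y|g₀p(g₀) < 8L²3R₁M₁r(g₀)g₀p(g₀), (28) and for g₀ sufficiently small the number on the
right-hand side above is small, so the function B can be used in the constructions of Sect. F [7]. This bound, with a
different absolute constant, extends to the whole configuration B»; (7) p. 257 «p(g) = b₀(1 + log g⁻¹)^{p₀}», «r(g) =
(1 + log g⁻¹)^{r₀}».

HONEST FRAMING (lane PLAN.md §0).  Nothing of the paper is asserted.  The hypothesis `small28 : cB·r(g_k)g_kp(g_k) ≤ ρ/4`
of the representation leaves (`…Proofs.Representation33.ChartExpansion.small28`, `…Proofs.Run3Representation`) — the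
chart configuration stays in the quarter of the (NOT IN PRINT, GAP G3D-01) analyticity radius `ρ` — is print's «for g₀
sufficiently small the number … is small»; this file names the threshold: `gamma28 ρ cB r₀ b₀ p₀ := min 1 ((ρ/4)/(cB·K +
1))²` with `K = b₀(2(p₀+r₀))^{p₀+r₀}e^{½−(p₀+r₀)}` the constant of seat p2's tangent-line bound
`CouplingWindow.gpx_le_sqrt` («g·p(g)·x(g)^{r₀} ≤ K·√g» on (0, 1]), and proves `small28_of_le_gamma28 : 0 < g ≤ gamma28 … →
cB·r(g)·g·p(g) ≤ ρ/4`.  Pure real arithmetic ([folklore]); `γ₂₈` joins p3's `gammaMin` list.  PLACEMENT: lane cell topic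
`Summits/QuantumFields/Balaban3D/Proofs/`.
-/

noncomputable section

namespace Summit.QuantumFields.Balaban3D.Proofs.ChartThreshold

open Literature.MathematicalPhysics.QuantumFieldTheory.Balaban1983to89
open B10LargeField (xlog pFun_eq rFun_eq one_le_xlog)
open Summit.QuantumFields.Balaban3D.Proofs.CouplingWindow (gpx_le_sqrt)

/-- The constant `K = b₀(2(p₀+r₀))^{p₀+r₀}e^{½−(p₀+r₀)}` of the tangent-line bound `g·p(g)·r(g) ≤ K√g` on (0, 1]
(seat p2's `CouplingWindow.gpx_le_sqrt`). [folklore] -/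
def K28 (r₀ b₀ p₀ : ℝ) : ℝ := b₀ * ((2 * (p₀ + r₀)) ^ (p₀ + r₀) * Real.exp (1 / 2 - (p₀ + r₀)))

/-- `0 ≤ K28` for `b₀ ≥ 0`, `p₀ + r₀ ≥ 0`. [folklore] -/
theorem K28_nonneg {r₀ b₀ p₀ : ℝ} (hb : 0 ≤ b₀) (hpr : 0 ≤ p₀ + r₀) : 0 ≤ K28 r₀ b₀ p₀ := by
  unfold K28
  have : 0 ≤ (2 * (p₀ + r₀)) ^ (p₀ + r₀) := Real.rpow_nonneg (by linarith) _
  positivity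

/-- **The threshold `γ₂₈` of (28)'s «for g₀ sufficiently small»**: `min 1 ((ρ/4)/(cB·K + 1))²` — below it the chart
configuration bound `cB·r(g)g p(g)` of (28) is at most a quarter of the analyticity radius `ρ`. [cite: Balaban1985UV3, (28) p.263] -/
def gamma28 (ρ cB r₀ b₀ p₀ : ℝ) : ℝ := min 1 (((ρ / 4) / (cB * K28 r₀ b₀ p₀ + 1)) ^ 2)

/-- `γ₂₈ ≤ 1`. [folklore] -/
theorem gamma28_le_one (ρ cB r₀ b₀ p₀ : ℝ) : gamma28 ρ cB r₀ b₀ p₀ ≤ 1 := min_le_left _ _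

/-- `γ₂₈ > 0` for `ρ > 0`, `cB, b₀ ≥ 0`, `p₀ + r₀ ≥ 0`. [folklore] -/
theorem gamma28_pos {ρ cB r₀ b₀ p₀ : ℝ} (hρ : 0 < ρ) (hcB : 0 ≤ cB) (hb : 0 ≤ b₀) (hpr : 0 ≤ p₀ + r₀) :
    0 < gamma28 ρ cB r₀ b₀ p₀ := by
  have hK := K28_nonneg (r₀ := r₀) hb hpr
  have hD : 0 < cB * K28 r₀ b₀ p₀ + 1 := by positivity
  unfold gamma28
  exact lt_min one_pos (by positivity)

/-- **EXPORT — (28)'s smallness below `γ₂₈`**: for `0 < g ≤ γ₂₈(ρ, cB, r₀, b₀, p₀)` (`ρ > 0`, `cB, b₀, r₀ ≥ 0`, `p₀ > 0`),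
`cB·r(g)·g·p(g) ≤ ρ/4` — the hypothesis `small28` of `…Proofs.Representation33.ChartExpansion` /
`…Proofs.Run3Representation.repr33_60_series` at `g = g_k`, hence discharged along the run by `g_k ≤ γ₀ ≤ γ₂₈` (seat p3's
`ScalesArithmetic.gk_le_gamma0_of_eps0Of`).  Via seat p2's `CouplingWindow.gpx_le_sqrt`. [cite: Balaban1985UV3, (28) p.263 + p.256] -/
theorem small28_of_le_gamma28 {ρ cB r₀ b₀ p₀ g : ℝ} (hρ : 0 < ρ) (hcB : 0 ≤ cB) (hb : 0 ≤ b₀) (hr : 0 ≤ r₀)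
    (hp : 0 < p₀) (hg : 0 < g) (hgγ : g ≤ gamma28 ρ cB r₀ b₀ p₀) :
    cB * (B10.rFun r₀ g * g * B10.pFun b₀ p₀ g) ≤ ρ / 4 := by
  have hg1 : g ≤ 1 := hgγ.trans (gamma28_le_one ρ cB r₀ b₀ p₀)
  have hK : 0 ≤ K28 r₀ b₀ p₀ := K28_nonneg hb (by linarith)
  have h1 : g * B10.pFun b₀ p₀ g * xlog g ^ r₀ ≤ K28 r₀ b₀ p₀ * Real.sqrt g :=
    gpx_le_sqrt b₀ p₀ r₀ g hb (by linarith) hg hg1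
  have hid : B10.rFun r₀ g * g * B10.pFun b₀ p₀ g = g * B10.pFun b₀ p₀ g * xlog g ^ r₀ := by
    rw [rFun_eq]; ring
  set D : ℝ := cB * K28 r₀ b₀ p₀ + 1 with hDdef
  have hD : 0 < D := by positivity
  have hsq : Real.sqrt g ≤ (ρ / 4) / D := by
    have hle : g ≤ ((ρ / 4) / D) ^ 2 := hgγ.trans (min_le_right _ _)
    calc Real.sqrt g ≤ Real.sqrt (((ρ / 4) / D) ^ 2) := Real.sqrt_le_sqrt hle
      _ = (ρ / 4) / D := Real.sqrt_sq (by positivity)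
  have hcK : cB * K28 r₀ b₀ p₀ / D ≤ 1 := by
    rw [div_le_one hD, hDdef]; linarith
  calc cB * (B10.rFun r₀ g * g * B10.pFun b₀ p₀ g)
      = cB * (g * B10.pFun b₀ p₀ g * xlog g ^ r₀) := by rw [hid]
    _ ≤ cB * (K28 r₀ b₀ p₀ * Real.sqrt g) := mul_le_mul_of_nonneg_left h1 hcB
    _ ≤ cB * (K28 r₀ b₀ p₀ * ((ρ / 4) / D)) :=
        mul_le_mul_of_nonneg_left (mul_le_mul_of_nonneg_left hsq hK) hcB
    _ = (cB * K28 r₀ b₀ p₀ / D) * (ρ / 4) := by ring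
    _ ≤ 1 * (ρ / 4) := mul_le_mul_of_nonneg_right hcK (by positivity)
    _ = ρ / 4 := one_mul _

end Summit.QuantumFields.Balaban3D.Proofs.ChartThreshold

end
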